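import Literature.Analysis.UnboundedOperators.SemilinearMildTubeLipschitz
import Literature.Analysis.UnboundedOperators.SemilinearMildTubeLocal
import Literature.Analysis.UnboundedOperators.SemilinearMildTubeStep
import HarnessLib

/-!
# Mild solutions in a tube around a reference trajectory: continuation, Lipschitz stability and
# smooth dependence up to a prescribed time

Analysis/UnboundedOperators support file (everything proved; no definitions, no named facts).  Let `E` be
a real Banach space, `T(t)` (`t ≥ 0`) a strongly continuous contraction semigroup (`T(0) = 1`,
`T(s + t) = T(s) T(t)`, `‖T(t)‖ ≤ 1`), `K(t)` (`t > 0`) bounded operators, strongly continuous on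
`(0, ∞)`, weakly singular (`‖K(t)‖ ≤ C t^{−α}`, `C ≥ 0`, `α < 1`) and intertwined (`K(s + t) = T(s) K(t)`;
the abstract `A^α e^{−tA}`), `N` a bounded bilinear map and `f ∈ E`.  Let `yc ∈ C([0, L]; E)` be a mild
solution on `[0, L]`,

  `y(t) = T(t) y(0) + ∫₀ᵗ T(t − s) f ds − ∫₀ᵗ K(t − s) N(y(s), y(s)) ds`     (`0 ≤ t ≤ L`).

`exists_mildTube`: for every `ε > 0` there are `δ > 0`, `Lip` and a solution map
`Ψ : E → C([0, L]; E)` such that `Ψ` is continuous on the ball `‖y₀ − yc(0)‖ < δ`, `y₀ ↦ Ψ y₀ (t)` is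
`C^∞` on that ball for every `t`, and for `‖y₀ − yc(0)‖ < δ`: `Ψ y₀` is a mild solution on `[0, L]`
from `y₀`; `‖Ψ y₀ (t) − yc(t)‖ ≤ Lip ‖y₀ − yc(0)‖ < ε`; and for every `h` the derivative
`w(t) = D(Ψ · (t))(y₀) h` is continuous in `t` and solves the linearised mild equation
`w(t) = T(t) h − ∫₀ᵗ K(t − s) (N(y(s), w(s)) + N(w(s), y(s))) ds` along `y = Ψ y₀`.

This is D. Henry, *Geometric Theory of Semilinear Parabolic Equations*, LNM 840 (1981), Thm. 3.3.4
(continuation as long as the solution stays bounded), Thm. 3.4.1 (Lipschitz dependence on the initial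
value) and Thm. 3.4.4 / Cor. 3.4.6 (smooth dependence; the derivative solves the linearisation), organised
as follows.  With `ρ = ‖yc‖_∞ + 2` the local flow of `SemilinearMildTubeLocal.lean` exists on every window
of length `τ ≤ τ₀(ρ)` from every datum of norm `< ρ`, is `C^∞`, bounded by `ρ + 1`, with the derivative
identity; take `τ = L/n`.  With the Lipschitz constant `Lip` of `SemilinearMildTubeLipschitz.lean` for the
bound `ρ + 1` and the horizon `L`, and `δ = min(ε, 1)/(Lip + 1)`, the step `mildTube_step`
(`SemilinearMildTubeStep.lean`) is iterated `n` times starting from the constant family `U y t = y` on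
`[0, 0]`: at each junction the solution is within `Lip δ ≤ 1` of `yc`, hence of norm `< ρ`, so the local
flow restarts, and the six properties (continuity, mild identity, tube estimate, per-time smoothness,
continuity and identity of the derivative) propagate to `[0, L]`.  Finally the family is packaged as a
map into `C([0, L]; E)` (zero outside the ball), continuous there by the Lipschitz estimate between two
solutions.

## References

* D. Henry, *Geometric Theory of Semilinear Parabolic Equations*, LNM 840, Springer (1981), Thm. 3.3.3,
  Thm. 3.3.4, Thm. 3.4.1, Thm. 3.4.4, Cor. 3.4.6, Lemma 7.1.1. [Henry1981]
* A. Pazy, *Semigroups of Linear Operators and Applications to Partial Differential Equations*, Springer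
  (1983), §6.3, Thm. 6.3.1. [Pazy1983]
-/

noncomputable section

open Set Filter MeasureTheory intervalIntegral Metric
open _root_.Topology
open scoped ContDiff

namespace Literature.Analysis.UnboundedOperators

variable {E : Type*} [NormedAddCommGroup E] [NormedSpace ℝ E] [CompleteSpace E]

/-- **Mild solutions in a tube around a reference trajectory** (Henry 1981, Thm. 3.3.4, Thm. 3.4.1 and
Cor. 3.4.6).  Let `T` be a strongly continuous contraction semigroup on a real Banach space `E`, `K`
strongly continuous on `(0, ∞)` with `‖K t‖ ≤ C t^{−α}` (`C ≥ 0`, `α < 1`) and `K (s + t) = T s ∘ K t`,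
`N` bounded bilinear, `f ∈ E`, and `yc ∈ C([0, L]; E)` (`L > 0`) a mild solution of
`y(t) = T t y(0) + ∫₀ᵗ T(t − s) f ds − ∫₀ᵗ K(t − s) N(y(s), y(s)) ds`.  For every `ε > 0` there are
`δ > 0`, `Lip` and `Ψ : E → C([0, L]; E)` with: `Ψ` continuous on the ball `‖y₀ − yc 0‖ < δ`;
`y₀ ↦ Ψ y₀ t` of class `C^∞` on the ball for every `t`; and for `‖y₀ − yc 0‖ < δ`: `Ψ y₀` is a mild
solution on `[0, L]` from `y₀`, `‖Ψ y₀ t − yc t‖ ≤ Lip ‖y₀ − yc 0‖` and `< ε`, and for every `h` the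
derivative `t ↦ D(Ψ · t)(y₀) h` is continuous and solves the linearised mild equation along `Ψ y₀`.
[cite: Henry1981, Thm 3.3.4, Thm 3.4.1 and Cor 3.4.6] -/
theorem exists_mildTube (T K : ℝ → E →L[ℝ] E) (hT0 : T 0 = 1)
    (hTadd : ∀ s t, 0 ≤ s → 0 ≤ t → T (s + t) = (T s).comp (T t))
    (hTnorm : ∀ t, 0 ≤ t → ‖T t‖ ≤ 1) (hTc : ∀ y : E, Continuous fun t : ℝ => T t y)
    {α C : ℝ} (hα : α < 1) (hC : 0 ≤ C) (hK : ∀ t, 0 < t → ‖K t‖ ≤ C * t ^ (-α))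
    (hKadd : ∀ s t, 0 ≤ s → 0 < t → K (s + t) = (T s).comp (K t))
    (hKc : ∀ y : E, ContinuousOn (fun t : ℝ => K t y) (Ioi 0))
    (N : E →L[ℝ] E →L[ℝ] E) (f : E) {L : ℝ} (hL : 0 < L) (yc : C(Icc (0 : ℝ) L, E))
    (hyc : ∀ t : Icc (0 : ℝ) L, yc t = T t (yc ⟨0, le_rfl, hL.le⟩) +
      (∫ s in (0 : ℝ)..(t : ℝ), T ((t : ℝ) - s) f) -
      ∫ s in (0 : ℝ)..(t : ℝ), K ((t : ℝ) - s)
        (N (yc (Set.projIcc 0 L hL.le s)) (yc (Set.projIcc 0 L hL.le s))))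
    {ε : ℝ} (hε : 0 < ε) :
    ∃ δ : ℝ, 0 < δ ∧ ∃ Lip : ℝ, ∃ Ψ : E → C(Icc (0 : ℝ) L, E),
      ContinuousOn Ψ (Metric.ball (yc ⟨0, le_rfl, hL.le⟩) δ) ∧
      (∀ t : Icc (0 : ℝ) L, ContDiffOn ℝ ∞ (fun y₀ => Ψ y₀ t) (Metric.ball (yc ⟨0, le_rfl, hL.le⟩) δ)) ∧
      ∀ y₀ ∈ Metric.ball (yc ⟨0, le_rfl, hL.le⟩) δ,
        (∀ t : Icc (0 : ℝ) L, Ψ y₀ t = T t y₀ + (∫ s in (0 : ℝ)..(t : ℝ), T ((t : ℝ) - s) f) -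
          ∫ s in (0 : ℝ)..(t : ℝ), K ((t : ℝ) - s)
            (N (Ψ y₀ (Set.projIcc 0 L hL.le s)) (Ψ y₀ (Set.projIcc 0 L hL.le s)))) ∧
        (∀ t : Icc (0 : ℝ) L, ‖Ψ y₀ t - yc t‖ ≤ Lip * ‖y₀ - yc ⟨0, le_rfl, hL.le⟩‖ ∧
          ‖Ψ y₀ t - yc t‖ < ε) ∧
        ∀ h : E, Continuous (fun t : Icc (0 : ℝ) L => fderiv ℝ (fun y => Ψ y t) y₀ h) ∧
          ∀ t : Icc (0 : ℝ) L, fderiv ℝ (fun y => Ψ y t) y₀ h = T t h -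
            ∫ s in (0 : ℝ)..(t : ℝ), K ((t : ℝ) - s)
              (N (Ψ y₀ (Set.projIcc 0 L hL.le s))
                  (fderiv ℝ (fun y => Ψ y (Set.projIcc 0 L hL.le s)) y₀ h) +
                N (fderiv ℝ (fun y => Ψ y (Set.projIcc 0 L hL.le s)) y₀ h)
                  (Ψ y₀ (Set.projIcc 0 L hL.le s))) := by
  classical
  -- ### the reference trajectory as a curve on `ℝ` (clamped outside `[0, L]`)
  set Yc : ℝ → E := fun s => yc (Set.projIcc 0 L hL.le s) with hYcdef
  have hYc : Continuous Yc := yc.continuous.comp continuous_projIcc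
  have hYcv : ∀ (t : ℝ) (ht : t ∈ Icc 0 L), Yc t = yc ⟨t, ht⟩ := fun t ht => by
    rw [hYcdef]
    dsimp only
    rw [Set.projIcc_of_mem hL.le ht]
  have hYc0 : Yc 0 = yc ⟨0, le_rfl, hL.le⟩ := hYcv 0 ⟨le_rfl, hL.le⟩
  have hYb' : ∀ s, ‖Yc s‖ ≤ ‖yc‖ := fun s => yc.norm_coe_le_norm _
  have hYm : ∀ t ∈ Icc 0 L, Yc t = T t (Yc 0) + (∫ s in (0 : ℝ)..t, T (t - s) f) -
      ∫ s in (0 : ℝ)..t, K (t - s) (N (Yc s) (Yc s)) := fun t ht => by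
    rw [hYcv t ht, hYc0]
    exact hyc ⟨t, ht⟩
  -- ### radii, the local flow on a window `τ = L / n`, the Lipschitz constant, the tube radius
  set ρ : ℝ := ‖yc‖ + 2 with hρ
  have hρ0 : 0 < ρ := by positivity
  have hYb : ∀ t, ‖Yc t‖ + 2 ≤ ρ := fun t => by linarith [hYb' t]
  obtain ⟨τ₀, hτ₀, hloc⟩ := exists_smoothMildFlow_forall_le T K hTnorm hTc hα hC hK hKc N f hρ0
  obtain ⟨n, hn0, hnτ⟩ : ∃ n : ℕ, 0 < n ∧ L / n ≤ τ₀ := by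
    refine ⟨⌈L / τ₀⌉₊, Nat.ceil_pos.2 (div_pos hL hτ₀), ?_⟩
    rw [div_le_iff₀ (Nat.cast_pos.2 (Nat.ceil_pos.2 (div_pos hL hτ₀)))]
    calc L = τ₀ * (L / τ₀) := by field_simp
      _ ≤ τ₀ * ⌈L / τ₀⌉₊ := mul_le_mul_of_nonneg_left (Nat.le_ceil _) hτ₀.le
  have hn' : (n : ℝ) ≠ 0 := (Nat.cast_pos.2 hn0).ne'
  set τ : ℝ := L / n with hτdef
  have hτ : 0 < τ := div_pos hL (Nat.cast_pos.2 hn0)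
  have hnτ' : (n : ℝ) * τ = L := by rw [hτdef]; field_simp
  obtain ⟨Φl, hΦs, hΦm, hΦb, -, hΦd⟩ := hloc τ hτ hnτ
  obtain ⟨Lip, hLip1, hLip⟩ := exists_forall_norm_sub_le_of_mild T K hTnorm hα hC hK hKc N f (ρ + 1) L
  have hLip0 : 0 < Lip := by linarith
  set δ : ℝ := min ε 1 / (Lip + 1) with hδdef
  have hm0 : 0 < min ε 1 := lt_min hε one_pos
  have hδ0 : 0 < δ := div_pos hm0 (by linarith)
  have hLδ1 : Lip * δ < min ε 1 := by
    rw [hδdef, mul_div_assoc', div_lt_iff₀ (by linarith : 0 < Lip + 1)]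
    nlinarith
  have hLδ : Lip * δ ≤ 1 := hLδ1.le.trans (min_le_right _ _)
  have hLδε : Lip * δ < ε := hLδ1.trans_le (min_le_left _ _)
  -- ### the iteration over the windows `[k τ, (k + 1) τ]`
  have key : ∀ k : ℕ, k ≤ n → ∃ U : E → ℝ → E,
      (∀ y ∈ ball (Yc 0) δ, Continuous (U y)) ∧
      (∀ y ∈ ball (Yc 0) δ, ∀ t ∈ Icc 0 ((k : ℝ) * τ), U y t = T t y +
        (∫ s in (0 : ℝ)..t, T (t - s) f) - ∫ s in (0 : ℝ)..t, K (t - s) (N (U y s) (U y s))) ∧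
      (∀ y ∈ ball (Yc 0) δ, ∀ t ∈ Icc 0 ((k : ℝ) * τ), ‖U y t - Yc t‖ ≤ Lip * ‖y - Yc 0‖) ∧
      (∀ t, ContDiffOn ℝ ∞ (fun y => U y t) (ball (Yc 0) δ)) ∧
      (∀ y ∈ ball (Yc 0) δ, ∀ h : E, Continuous fun t => fderiv ℝ (fun z => U z t) y h) ∧
      (∀ y ∈ ball (Yc 0) δ, ∀ h : E, ∀ t ∈ Icc 0 ((k : ℝ) * τ),
        fderiv ℝ (fun z => U z t) y h = T t h - ∫ s in (0 : ℝ)..t, K (t - s)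
          (N (U y s) (fderiv ℝ (fun z => U z s) y h) +
            N (fderiv ℝ (fun z => U z s) y h) (U y s))) := by
    intro k
    induction k with
    | zero =>
      intro _
      refine ⟨fun y _ => y, fun y _ => continuous_const, ?_, ?_, fun t => contDiffOn_id, ?_, ?_⟩
      · intro y _ t ht
        rw [Nat.cast_zero, zero_mul] at ht
        have ht0 : t = 0 := le_antisymm ht.2 ht.1
        subst ht0
        simp [hT0]
      · intro y _ t ht
        rw [Nat.cast_zero, zero_mul] at ht
        have ht0 : t = 0 := le_antisymm ht.2 ht.1
        subst ht0
        exact le_mul_of_one_le_left (norm_nonneg _) hLip1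
      · intro y _ h
        simp only [fderiv_fun_id, ContinuousLinearMap.id_apply]
        exact continuous_const
      · intro y _ h t ht
        rw [Nat.cast_zero, zero_mul] at ht
        have ht0 : t = 0 := le_antisymm ht.2 ht.1
        subst ht0
        simp [hT0]
    | succ k ih =>
      intro hk
      obtain ⟨U, hA, hB, hCt, hD, hE, hF⟩ := ih (Nat.le_of_succ_le hk)
      have ha : (0 : ℝ) ≤ k * τ := by positivity
      have haL : (k : ℝ) * τ + τ ≤ L := by
        calc (k : ℝ) * τ + τ = ((k + 1 : ℕ) : ℝ) * τ := by push_cast; ring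
          _ ≤ n * τ := by gcongr
          _ = L := hnτ'
      obtain ⟨h1, h2, h3, h4, h5, h6⟩ := mildTube_step T K hT0 hTadd hTc hα hK hKadd hKc N f hτ hΦs
        hΦm hΦb hΦd hYc hYm hYb hLip0.le hLip hLδ ha haL hA hB hCt hD hE hF
        (U' := fun y t => if t ≤ k * τ then U y t
          else Φl (U y (k * τ)) (Set.projIcc 0 τ hτ.le (t - k * τ))) fun _ _ => rfl
      have e : ((k + 1 : ℕ) : ℝ) * τ = k * τ + τ := by push_cast; ring
      rw [e]
      exact ⟨_, h1, h2, h3, h4, h5, h6⟩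
  -- ### the family on `[0, L]` and its packaging as a map into `C([0, L]; E)`
  obtain ⟨U, hA, hB, hCt, hD, hE, hF⟩ := key n le_rfl
  rw [hnτ'] at hB hCt hF
  have hUb : ∀ y ∈ ball (Yc 0) δ, ∀ t ∈ Icc 0 L, ‖U y t‖ ≤ ρ + 1 := by
    intro y hy t ht
    have h1 : ‖U y t - Yc t‖ ≤ 1 :=
      (hCt y hy t ht).trans ((mul_le_mul_of_nonneg_left (mem_ball_iff_norm.1 hy).le hLip0.le).trans
        hLδ)
    linarith [norm_le_insert' (U y t) (Yc t), hYb t]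
  obtain ⟨Ψ, hΨdef⟩ : ∃ Ψ : E → C(Icc (0 : ℝ) L, E), ∀ y, Ψ y = if hy : y ∈ ball (Yc 0) δ then
      ⟨fun t => U y t, (hA y hy).comp continuous_subtype_val⟩ else 0 := ⟨_, fun y => rfl⟩
  have hΨ : ∀ y ∈ ball (Yc 0) δ, ∀ t : Icc (0 : ℝ) L, Ψ y t = U y t := fun y hy t => by
    rw [hΨdef, dif_pos hy]
    rfl
  have hΨev : ∀ y ∈ ball (Yc 0) δ, ∀ t : Icc (0 : ℝ) L,
      (fun z => Ψ z t) =ᶠ[𝓝 y] fun z => U z t := fun y hy t =>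
    Filter.eventuallyEq_of_mem (isOpen_ball.mem_nhds hy) fun z hz => hΨ z hz t
  have hfd : ∀ y ∈ ball (Yc 0) δ, ∀ (t : Icc (0 : ℝ) L) (h : E),
      fderiv ℝ (fun z => Ψ z t) y h = fderiv ℝ (fun z => U z t) y h := fun y hy t h => by
    rw [(hΨev y hy t).fderiv_eq]
  have hLipΨ : ∀ y ∈ ball (Yc 0) δ, ∀ y' ∈ ball (Yc 0) δ, ‖Ψ y - Ψ y'‖ ≤ Lip * ‖y - y'‖ :=
    fun y hy y' hy' => (ContinuousMap.norm_le _ (by positivity)).2 fun t => by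
      rw [ContinuousMap.sub_apply, hΨ y hy, hΨ y' hy']
      exact hLip L le_rfl (U y) (U y') y y' (hA y hy) (hA y' hy') (hB y hy) (hB y' hy') (hUb y hy)
        (hUb y' hy') t t.2
  rw [← hYc0]
  refine ⟨δ, hδ0, Lip, Ψ, ?_, fun t => (hD t).congr fun y hy => hΨ y hy t, fun y₀ hy₀ =>
    ⟨fun t => ?_, fun t => ?_, fun h => ⟨?_, fun t => ?_⟩⟩⟩
  · -- continuity into `C([0, L]; E)` (Lipschitz estimate between two solutions)
    refine (LipschitzOnWith.of_dist_le_mul fun y hy y' hy' => ?_).continuousOn (K := Lip.toNNReal)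
    rw [dist_eq_norm, dist_eq_norm, Real.coe_toNNReal _ hLip0.le]
    exact hLipΨ y hy y' hy'
  · -- the mild identity on `[0, L]`
    rw [hΨ y₀ hy₀ t, hB y₀ hy₀ t t.2]
    congr 1
    refine intervalIntegral.integral_congr fun s hs => ?_
    rw [uIcc_of_le t.2.1] at hs
    have hs' : s ∈ Icc 0 L := ⟨hs.1, hs.2.trans t.2.2⟩
    rw [Set.projIcc_of_mem hL.le hs', hΨ y₀ hy₀ ⟨s, hs'⟩]
  · -- the tube estimate
    rw [hΨ y₀ hy₀ t, ← hYcv t t.2]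
    have h := hCt y₀ hy₀ t t.2
    exact ⟨h, h.trans_lt ((mul_lt_mul_of_pos_left (mem_ball_iff_norm.1 hy₀) hLip0).trans hLδε)⟩
  · -- continuity of the derivative in `t`
    have heq : (fun t : Icc (0 : ℝ) L => fderiv ℝ (fun y => Ψ y t) y₀ h) =
        fun t : Icc (0 : ℝ) L => fderiv ℝ (fun z => U z t) y₀ h := funext fun t => hfd y₀ hy₀ t h
    rw [heq]
    exact (hE y₀ hy₀ h).comp continuous_subtype_val
  · -- the linearised identity
    rw [hfd y₀ hy₀ t h, hF y₀ hy₀ h t t.2]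
    congr 1
    refine intervalIntegral.integral_congr fun s hs => ?_
    rw [uIcc_of_le t.2.1] at hs
    have hs' : s ∈ Icc 0 L := ⟨hs.1, hs.2.trans t.2.2⟩
    rw [Set.projIcc_of_mem hL.le hs', hΨ y₀ hy₀ ⟨s, hs'⟩, hfd y₀ hy₀ ⟨s, hs'⟩ h]

end Literature.Analysis.UnboundedOperators

end
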